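import Summits.BirchSwinnertonDyer.Rank1Residual.X5.TwoAdicTargetsLead
import Literature.NumberTheory.EllipticCurves.LangHeightNonarchEstimate
import Literature.NumberTheory.EllipticCurves.TamagawaSubgroupProofs
import Literature.NumberTheory.EllipticCurves.TamagawaFiniteIndexProofs
import HarnessLib

/-!
# O1 (X5 at `p = 2`, non-CM): `TamagawaRemovalAtTwo` — the Jetchev local-divisibility shape at `2`

HONEST FRAMING (cell `b2b-bsdres`, run/shared/lean/b2b/bsd-rank1-residual/, verbatim in every
file): the goal of the cell is to DELETE the COMBINATION-SHAPED residual classes of the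
Birch–Swinnerton-Dyer formula for ALL analytic-rank `≤ 1` elliptic curves over `ℚ` — "full BSD
formula for every rank `≤ 1` curve in class `C`" assembled STRICTLY from published theorems — so
that the rank-`≤ 1` remainder becomes exactly the CONSTRUCTION-SHAPED classes, which are TYPED
(missing-input `Prop`s), NOT attempted. This is not "finishing BSD". Research routes; no claim
beyond stated classes; census output = EVIDENCE, never a Literature fact; nothing here is booked;
no mark of RESIDUAL-MAP §I moves.

Typer file 4 of the O1 class-closure folder (seat cc-typer-4; o1 lead gen 3 ruling 2026-08-21
05:31Z (2), after o1-lens-4's SLACK-LEDGER v1 shape **J**). TYPED TARGETS and PROVED bookkeeping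
only: nothing below is asserted, nothing is a Literature fact, no RESIDUAL-MAP mark moves.

* **Printed antecedent (odd `p`, rank one over the Heegner field).** D. Jetchev, *Global
  divisibility of Heegner points and Tamagawa numbers*, Compos. Math. 144 (2008) 811–826
  (held author text `paper:arxiv-math_0703431`, chunk p0003): for `E/ℚ` of conductor `N`, `K` an
  imaginary quadratic field in which every prime factor of `N` splits, `y_K` the Heegner point, of
  infinite order, and an ODD prime `p` with Hypothesis (∗) "`p ∤ N` and `ρ_{E,p} : Gal(ℚ̄/ℚ) →
  GL(E[p])` is surjective": Thm. 1.4 "If `m_max = max_{q ∣ N} ord_p(c_q)`, then `m_∞ ≥ m_max`";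
  Cor. 1.5 "`#Ш(E/K)[p^∞] ≤ p^{2m₀ - 2m_max}`", `m₀ = ord_p [E(K) : ℤ y_K]` (§1.5, p0007), refining
  Kolyvagin's `ord_p #Ш(E/K) ≤ 2 ord_p [E(K) : ℤ y_K]` (tree: the named fact
  `Kolyvagin1990_padicValNat_card_sha_le`, itself printed for ODD `p` only — McCallum 1991 §1,
  Gross 1991 Thm. 1.3 (2) with `2 ∣ t_{E/K}` always).
* **What is typed here.** (§1) `O1.TamagawaRemovalAtTwo W δ` — lens-4's shape **J** over `ℚ` in
  analytic rank `0` on sub-target O1-A (the binders of `O1.UpperBoundAtTwoOfBigImage`): an upper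
  bound for `ord₂ #Ш(E/ℚ)` by `ord₂ #Ш_an + ord₂ ∏_ℓ c_ℓ - ord₂ c_v` for EVERY finite place `v`
  (equivalently: the product of Tamagawa numbers is lost but the largest `2`-power among them is
  recovered), with `δ` bits of slack. Census value of record (lens-4 SLACK-LEDGER v1, column J − T):
  658 candidate cells at `δ = 0`, 949 at `δ = 1`; named falsifier set = the 78 candidate classes
  with `s_J = ord₂ ∏ c_ℓ - max_ℓ ord₂ c_ℓ ≥ 2`. (§2) `O1.TamagawaRemovalAtTwoHeegner W N K δ` —
  Jetchev's Cor. 1.5 READ AT `p = 2` over the Heegner field, verbatim in the vocabulary of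
  `KolyvaginShaIndexBound.lean`, and `O1.KolyvaginIndexBoundAtTwo W N K δ` — Kolyvagin's bound read
  at `2` (the Tamagawa term dropped). (§3) PROVED bookkeeping: shape W ⇒ shape J; shape J at a
  place carrying all but `s` bits of `ord₂ ∏ c_ℓ` ⇒ shape W with slack `δ + s` (so `s_J = 0` cells
  reduce to `O1.UpperBoundAtTwoOfBigImage W δ` and close by
  `O1.bsdp_two_of_upperBound_zero_of_lowerBound` at `δ = 0`, resp. by the slack-one lemma of
  `X5/TwoAdicTargetsB.lean` at `δ + s_J = 1`); Jetchev-at-2 ⇒ Kolyvagin-at-2; the GZ–BSD identity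
  schema `O1.RankOneIndexIdentityAtTwo` ⇒ Jetchev-at-2 (shape J is weaker than BSD over `K`).
* **WHY IT MIGHT FAIL at `2` (the research price, per lens-4 and the source).** Jetchev §§4–5 run
  Kolyvagin's system at an odd `p`: Kolyvagin primes `ℓ` with `Frob_ℓ` = complex conjugation in
  `K(E[p^m])/ℚ` and the `±`-eigenspace decomposition under `τ` (division by `2`); the odd-`p`
  normalisations of local Tate duality and of the unramified-cohomology/component-group lemma
  (p0009, p0013: `E⁰(K_v^{ur})` is `p`-divisible, `H¹(K_v^{ur}/K_v, E)[p^m]` versus `Φ_v(𝔽_v)[p^m]`);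
  at `2` the component group `Φ_q(𝔽_q)[2]` interacts with `E(ℚ_q)[2]`, and the restriction bit
  (H.3) of Rubin's Kolyvagin-system axioms is needed. Under `O1.TwoAdicSurjective W` the torsion
  terms are harmless (`ρ̄_{E,2}` onto `GL₂(𝔽₂) ≅ S₃` forces `E(ℚ)[2] = 0`, and `E(K)[2] = 0` since a
  root of the `2`-division cubic generates a cubic field), which is why no `#E(ℚ)[2^∞]²` binder
  appears: `#Ш_an` already carries `#E(ℚ)_tors²`.

References: [Jetchev2008] Thm. 1.4, Cor. 1.5 (p0003), §1.5 (p0007); [McCallumLMS1991] §1;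
[GrossLMS1991] Thm. 1.3 (2); [Miller2011LMS] §1 (`#Ш_an`).
-/

noncomputable section

open scoped Classical

open WeierstrassCurve NumberField IsDedekindDomain Literature.NumberTheory.EllipticCurves
  Literature.NumberTheory.EllipticCurves.Rank1Residual
  Literature.NumberTheory.EllipticCurves.Rank1Residual.Typed

set_option autoImplicit false

namespace Summit.BirchSwinnertonDyer.Rank1Residual.X5.O1

variable (W : WeierstrassCurve ℚ) [W.IsElliptic] [W.IsGloballyMinimal]

/-! ## §0 Two arithmetic helpers on the Tamagawa factors -/

omit [W.IsGloballyMinimal] in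
/-- Each local Tamagawa number divides the Tamagawa product (`∏ c_ℓ` is the `finprod` of the
finitely supported family `c_v`, `tamagawaProduct_eq_finprod_tamagawaNumberAt`,
`mulSupport_localTamagawaNumber_finite_holds`). [folklore] -/
theorem tamagawaNumberAt_dvd_tamagawaProduct (v : HeightOneSpectrum (𝓞 ℚ)) :
    W.tamagawaNumberAt v ∣ W.tamagawaProduct := by
  have hfin : (Function.mulSupport fun v : HeightOneSpectrum (𝓞 ℚ) => W.tamagawaNumberAt v).Finite :=
    W.mulSupport_localTamagawaNumber_finite_holds
  have hsub : (Function.mulSupport fun v : HeightOneSpectrum (𝓞 ℚ) => W.tamagawaNumberAt v) ⊆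
      ↑(insert v hfin.toFinset) := fun u hu => by
    rw [Finset.coe_insert]
    exact Set.mem_insert_of_mem _ (hfin.mem_toFinset.mpr hu)
  rw [W.tamagawaProduct_eq_finprod_tamagawaNumberAt, finprod_eq_prod_of_mulSupport_subset _ hsub]
  exact Finset.dvd_prod_of_mem _ (Finset.mem_insert_self v _)

omit [W.IsGloballyMinimal] in
/-- Hence `ord_p c_v ≤ ord_p ∏ c_ℓ` at every place (the product is positive,
`tamagawaProduct_pos'`). [folklore] -/
theorem padicValNat_tamagawaNumberAt_le (p : ℕ) [Fact p.Prime] (v : HeightOneSpectrum (𝓞 ℚ)) :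
    padicValNat p (W.tamagawaNumberAt v) ≤ padicValNat p W.tamagawaProduct := by
  obtain ⟨c, hc⟩ := tamagawaNumberAt_dvd_tamagawaProduct W v
  have hpos : 0 < W.tamagawaProduct := W.tamagawaProduct_pos'
  have hv0 : W.tamagawaNumberAt v ≠ 0 := fun h => by rw [hc, h, zero_mul] at hpos; exact lt_irrefl 0 hpos
  have hc0 : c ≠ 0 := fun h => by rw [hc, h, mul_zero] at hpos; exact lt_irrefl 0 hpos
  rw [hc, padicValNat.mul hv0 hc0]
  exact Nat.le_add_right _ _

/-! ## §1 Shape J over `ℚ` in analytic rank `0` (sub-target O1-A) -/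

/-- **`TamagawaRemovalAtTwo W δ` — the Jetchev shape at `2`, over `ℚ`, rank `0`, with `δ` bits of
slack (o1-lens-4 SLACK-LEDGER v1 shape J; o1 lead gen 3).** For `E/ℚ` (globally minimal `W`)
without CM, of analytic rank `0`, good ordinary or multiplicative at `2`, with `ρ_{E,2^∞}`
surjective (the binders of `O1.UpperBoundAtTwoOfBigImage`): `#Ш_an = q ∈ ℚ` and, for EVERY finite
place `v`, `ord₂ #Ш(E/ℚ) + ord₂ c_v ≤ ord₂ q + ord₂ ∏_ℓ c_ℓ + δ` — i.e. the finite-level Euler-system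
upper bound `ord₂ #Ш ≤ ord₂(L(E,1)/Ω_E) = ord₂ #Ш_an + ord₂ ∏ c_ℓ - 2 ord₂ #E(ℚ)_tors` (shape T,
GJPST 2009 Thm. 4.1 / Kato 14.5-type, printed for `p ∤ 6N`) IMPROVED by the largest Tamagawa
`2`-power `max_v ord₂ c_v` (Jetchev's Thm. 1.4 mechanism, printed for odd `p ∤ N` over the Heegner
field). `δ = 0` and `ord₂ ∏ c_ℓ = max_v ord₂ c_v` (at most one even Tamagawa number, up to odd
parts) give the BSD-sharp upper half `O1.UpperBoundAtTwoOfBigImage W 0`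
(`upperBoundAtTwoOfBigImage_of_tamagawaRemovalAtTwo`). NOT IN PRINT at `p = 2` for any `δ`; census
value of record 658 cells (`δ = 0`) / 949 (`δ = 1`), falsifier set = the 78 candidate classes with
`s_J ≥ 2`. A TARGET; nothing asserted.
[cite: Jetchev2008, Thm. 1.4 and Cor. 1.5 (held chunk p0003; odd p — shape only)] [cite: Miller2011LMS, §1 (#Ш_an)] -/
def TamagawaRemovalAtTwo (δ : ℕ) : Prop :=
  ¬ W.HasCM → W.analyticRank = 0 → (GoodOrd W 2 ∨ Mult W 2) → TwoAdicSurjective W →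
    ∃ q : ℚ, shaAn W = q ∧ ∀ v : HeightOneSpectrum (𝓞 ℚ),
      (padicValNat 2 W.shaOrder : ℤ) + padicValNat 2 (W.tamagawaNumberAt v) ≤
        padicValRat 2 q + padicValNat 2 W.tamagawaProduct + δ

/-- **Shape W ⇒ shape J**: the BSD-sharp upper bound with slack `δ` implies the Jetchev shape with
the same slack (because `ord₂ c_v ≤ ord₂ ∏ c_ℓ`). Sanity direction; bookkeeping. [folklore] -/
theorem tamagawaRemovalAtTwo_of_upperBoundAtTwoOfBigImage {δ : ℕ}
    (h : UpperBoundAtTwoOfBigImage W δ) : TamagawaRemovalAtTwo W δ := by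
  intro hCM hr hred hsurj
  haveI : Fact (Nat.Prime 2) := ⟨Nat.prime_two⟩
  obtain ⟨q, hq, hle⟩ := h hCM hr hred hsurj
  refine ⟨q, hq, fun v => ?_⟩
  have hv : (padicValNat 2 (W.tamagawaNumberAt v) : ℤ) ≤ padicValNat 2 W.tamagawaProduct := by
    exact_mod_cast padicValNat_tamagawaNumberAt_le W 2 v
  linarith

omit [W.IsElliptic] in
/-- **Shape J ⇒ shape W with the Jetchev excess as extra slack.** If at some place `v` the
Tamagawa `2`-power is concentrated up to `s` bits (`ord₂ ∏ c_ℓ ≤ ord₂ c_v + s`, i.e. lens-4's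
`s_J(E) ≤ s`), then the Jetchev shape with slack `δ` gives the BSD-sharp shape with slack `δ + s`.
[folklore] -/
theorem upperBoundAtTwoOfBigImage_of_tamagawaRemovalAtTwo_of_le {δ s : ℕ}
    (v : HeightOneSpectrum (𝓞 ℚ))
    (hs : padicValNat 2 W.tamagawaProduct ≤ padicValNat 2 (W.tamagawaNumberAt v) + s)
    (h : TamagawaRemovalAtTwo W δ) : UpperBoundAtTwoOfBigImage W (δ + s) := by
  intro hCM hr hred hsurj
  obtain ⟨q, hq, hall⟩ := h hCM hr hred hsurj
  refine ⟨q, hq, ?_⟩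
  have hv := hall v
  have hs' : (padicValNat 2 W.tamagawaProduct : ℤ) ≤ padicValNat 2 (W.tamagawaNumberAt v) + s := by
    exact_mod_cast hs
  rw [Nat.cast_add]
  linarith

omit [W.IsElliptic] in
/-- **The `s_J = 0` cells**: if ONE place carries the whole `2`-power of `∏ c_ℓ`
(`ord₂ ∏ c_ℓ = ord₂ c_v`; e.g. at most one even Tamagawa number), the Jetchev shape with slack `δ`
IS the BSD-sharp upper bound with slack `δ`; at `δ = 0` the cell then closes against a descent lower
bound by `O1.bsdp_two_of_upperBound_zero_of_lowerBound`. [folklore] -/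
theorem upperBoundAtTwoOfBigImage_of_tamagawaRemovalAtTwo {δ : ℕ} (v : HeightOneSpectrum (𝓞 ℚ))
    (hv : padicValNat 2 W.tamagawaProduct = padicValNat 2 (W.tamagawaNumberAt v))
    (h : TamagawaRemovalAtTwo W δ) : UpperBoundAtTwoOfBigImage W δ := by
  simpa using upperBoundAtTwoOfBigImage_of_tamagawaRemovalAtTwo_of_le W v (s := 0) (by omega) h

/-- **Odd Tamagawa product**: if `2 ∤ ∏ c_ℓ` the two shapes coincide outright (any place `v` works,
all `ord₂ c_v = 0`). [folklore] -/
theorem tamagawaRemovalAtTwo_iff_of_odd {δ : ℕ} (hodd : ¬ 2 ∣ W.tamagawaProduct)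
    (v : HeightOneSpectrum (𝓞 ℚ)) :
    TamagawaRemovalAtTwo W δ ↔ UpperBoundAtTwoOfBigImage W δ := by
  haveI : Fact (Nat.Prime 2) := ⟨Nat.prime_two⟩
  refine ⟨fun h => upperBoundAtTwoOfBigImage_of_tamagawaRemovalAtTwo W v ?_ h,
    tamagawaRemovalAtTwo_of_upperBoundAtTwoOfBigImage W⟩
  have h1 : padicValNat 2 W.tamagawaProduct = 0 := padicValNat.eq_zero_of_not_dvd hodd
  have h2 : padicValNat 2 (W.tamagawaNumberAt v) = 0 :=
    padicValNat.eq_zero_of_not_dvd fun hdv =>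
      hodd (dvd_trans hdv (tamagawaNumberAt_dvd_tamagawaProduct W v))
  rw [h1, h2]

/-! ## §2 Jetchev's Corollary 1.5 and Kolyvagin's bound READ AT `p = 2` over the Heegner field -/

/-- **`KolyvaginIndexBoundAtTwo W N K δ` — Kolyvagin's Heegner-index bound read at `p = 2`, with
`δ` bits of slack.** In the vocabulary of `Kolyvagin1990_padicValNat_card_sha_le` (which is printed,
and vendored, for ODD `p` only: McCallum 1991 §1 "if `p` is an odd prime"; Gross 1991 Thm. 1.3 (2),
`2 ∣ t_{E/K}` always): `K` imaginary quadratic with the Heegner hypothesis for `N`, `P = y_K` a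
Heegner point of infinite order, `ρ_{E,2^∞}` surjective ⇒
`ord₂ #Ш(E/K) ≤ 2 ord₂ [E(K) : ℤ y_K] + δ`. NOT IN PRINT at `2` for any `δ`. A TARGET; nothing
asserted. [cite: McCallumLMS1991, §1 Theorem (Kolyvagin), p. 296 (odd p — shape only)] -/
def KolyvaginIndexBoundAtTwo (N : ℕ) [NeZero N] (K : Type) [Field K] [NumberField K] (δ : ℕ) :
    Prop :=
  IsImaginaryQuadratic K → SatisfiesHeegnerHypothesis N K →
    ∀ ⦃P : (W.baseChange K).toAffine.Point⦄, IsHeegnerPoint N W K P → ¬ IsOfFinAddOrder P →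
    TwoAdicSurjective W →
      padicValNat 2 (W.baseChange K).shaOrder ≤ 2 * padicValNat 2 (AddSubgroup.zmultiples P).index + δ

/-- **`TamagawaRemovalAtTwoHeegner W N K δ` — Jetchev, Compos. Math. 144 (2008) Cor. 1.5 READ AT
`p = 2`, with `δ` bits of slack.** As printed (odd `p ∤ N`, `ρ̄_{E,p}` surjective, `y_K` of
infinite order): "`#Ш(E/K)[p^∞] ≤ p^{2m₀ - 2m_max}`, where `m_max = max_{q ∣ N} ord_p(c_q)`",
`m₀ = ord_p [E(K) : ℤ y_K]`; "In particular, if `p` divides at most one Tamagawa number, the above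
upper bound coincides with the exact upper bound … predicted by the Birch and Swinnerton-Dyer
conjectural formula for `E/K`" (`#Ш(E/K) = ([E(K) : ℤ y_K]/(c·∏_{q∣N} c_q))²`, Conj. 1.1). Here,
with the max over `q ∣ N` unfolded into a bound at EVERY finite place `v` of `ℚ` (`c_v = 1` at good
`v`): `K` imaginary quadratic, Heegner hypothesis for `N`, `P` a Heegner point of infinite order,
`ρ_{E,2^∞}` surjective ⇒ `ord₂ #Ш(E/K) + 2 ord₂ c_v ≤ 2 ord₂ [E(K) : ℤ P] + δ` for all `v`. NOT IN
PRINT at `2` for any `δ` (see the module docstring for the `2`-sensitive steps of §§4–5). A TARGET;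
nothing asserted. [cite: Jetchev2008, Thm. 1.4 and Cor. 1.5 (held chunk p0003), §1.5 (p0007)] -/
def TamagawaRemovalAtTwoHeegner (N : ℕ) [NeZero N] (K : Type) [Field K] [NumberField K] (δ : ℕ) :
    Prop :=
  IsImaginaryQuadratic K → SatisfiesHeegnerHypothesis N K →
    ∀ ⦃P : (W.baseChange K).toAffine.Point⦄, IsHeegnerPoint N W K P → ¬ IsOfFinAddOrder P →
    TwoAdicSurjective W → ∀ v : HeightOneSpectrum (𝓞 ℚ),
      padicValNat 2 (W.baseChange K).shaOrder + 2 * padicValNat 2 (W.tamagawaNumberAt v) ≤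
        2 * padicValNat 2 (AddSubgroup.zmultiples P).index + δ

/-! ## §3 Bookkeeping between the rank-one shapes -/

omit [W.IsElliptic] [W.IsGloballyMinimal] in
/-- Jetchev-at-2 ⇒ Kolyvagin-at-2 (drop the Tamagawa term). [folklore] -/
theorem kolyvaginIndexBoundAtTwo_of_tamagawaRemovalAtTwoHeegner {N : ℕ} [NeZero N] {K : Type}
    [Field K] [NumberField K] {δ : ℕ} (h : TamagawaRemovalAtTwoHeegner W N K δ) :
    KolyvaginIndexBoundAtTwo W N K δ := by
  intro hK hH P hP hnt hsurj
  classical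
  -- any place will do: its Tamagawa term is nonnegative
  obtain ⟨v⟩ : Nonempty (HeightOneSpectrum (𝓞 ℚ)) :=
    ⟨(Rat.HeightOneSpectrum.primesEquiv).symm ⟨2, Nat.prime_two⟩⟩
  have := h hK hH hP hnt hsurj v
  omega

omit [W.IsElliptic] [W.IsGloballyMinimal] in
/-- **Shape J is weaker than BSD over `K`**: the Gross–Zagier–BSD identity schema
`O1.RankOneIndexIdentityAtTwo W K P δ'` (`2 ord₂ ∏ c_ℓ + ord₂ #Ш(E/K) + δ' = 2 ord₂ [E(K) : ℤ P]`)
with `-δ ≤ δ'` implies Jetchev's inequality with slack `δ` at that point, for an elliptic `W`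
(`ord₂ c_v ≤ ord₂ ∏ c_ℓ`). Sanity direction; bookkeeping. [folklore] -/
theorem tamagawaRemovalAtTwoHeegner_of_rankOneIndexIdentityAtTwo [W.IsElliptic] {N : ℕ} [NeZero N]
    {K : Type} [Field K] [NumberField K] {δ : ℕ} {δ' : ℤ} (hδ : -(δ : ℤ) ≤ δ')
    (h : ∀ P : (W.baseChange K).toAffine.Point, IsHeegnerPoint N W K P → ¬ IsOfFinAddOrder P →
      RankOneIndexIdentityAtTwo W K P δ') :
    TamagawaRemovalAtTwoHeegner W N K δ := by
  intro _hK _hH P hP hnt _hsurj v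
  haveI : Fact (Nat.Prime 2) := ⟨Nat.prime_two⟩
  have hid := h P hP hnt
  unfold RankOneIndexIdentityAtTwo at hid
  have hv : (padicValNat 2 (W.tamagawaNumberAt v) : ℤ) ≤ padicValNat 2 W.tamagawaProduct := by
    exact_mod_cast padicValNat_tamagawaNumberAt_le W 2 v
  have : (padicValNat 2 (W.baseChange K).shaOrder : ℤ) + 2 * padicValNat 2 (W.tamagawaNumberAt v)
      ≤ 2 * padicValNat 2 (AddSubgroup.zmultiples P).index + δ := by linarith
  exact_mod_cast this

end Summit.BirchSwinnertonDyer.Rank1Residual.X5.O1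

end
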